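import Literature.NumberTheory.Automorphic.KernelCuspAction

/-!
# Truncation by constant terms and the compact part of an invariant integral operator on `L²(Γ\ℍ)`
(Iwaniec, *Spectral Methods of Automorphic Forms*, GSM 53, §4.2: Lemma 4.2, Props. 4.3, 4.5,
Cor. 4.4 ("the compact part `K̂ = K - H` of the automorphic kernel"), §6.4 (6.29) (truncation);
PDF pp. 49–51, 88)

Third brick of the Eisenstein-free proof of the pretrace estimate (12.5)
(`Literature.NumberTheory.Automorphic.Iwaniec2002_eq_12_5`), after `CuspHeightIsometry` and
`KernelCuspAction`. For a finite volume group with a complete system of inequivalent cusps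
`𝔞_i = σ_i∞` (width-one scalings) and a level `Y ≥ 1`:

1. (§1) the **truncation projection**: `Q = Σ_i V_i V_i†` is the orthogonal projection of `L²(F)` onto
   the functions of the height above `Y` in the cuspidal zones (`V_i` the cusp isometries of
   `CuspHeightIsometry`), `Λ = 1 - Q` ((6.29): subtracting the constant terms above `Y`);
   `V_i†V_i = 1`, `V_i†V_j = 0`, `V_i†Λ = 0`, `Q`, `Λ` self-adjoint idempotents.
2. (§2) **the constant terms of `T_k(Λf)` vanish above `Y e^{R}`** in every cusp
   (`cuspMeanAt_kernelOp_truncOp_eq_zero`): by the orthogonality criterion of `CuspHeightIsometry`,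
   the cusp action `T_k V_i^{(Ye^R)} = V_i^{(Y)}(g ⋆ ·)` of `KernelCuspAction` and `V_i†Λ = 0`.
3. (§3) **`T_k ∘ Λ` is compact** for every Lipschitz test kernel (`isCompactOperator_kernelCLM_comp_truncOp`):
   the cusp decay `|T_k g(σ_i z)| ≪ (Im z)^{-1/2}‖g‖` of Props. 4.3–4.5 for `g ∈ range Λ` high in the
   cusps (the argument of `FuchsianCuspFormsCompact` needs the vanishing of constant terms only along
   the horocycles met by the support of the kernel) and uniform equicontinuity on the compact core.

Everything here is proved; nothing is vendored; no fact is introduced.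

## References
* [Iwaniec2002] H. Iwaniec, *Spectral Methods of Automorphic Forms*, 2nd ed., GSM 53, AMS 2002,
  §4.2 (Lemma 4.2, Props. 4.3, 4.5, Cor. 4.4), PDF pp. 49–51; §6.4 (6.29), PDF p. 88
  (held copy `book:iwaniec2002-spectral-methods-automorphic-forms`).
-/

noncomputable section

open MeasureTheory Set Filter Real UpperHalfPlane
open scoped Topology MatrixGroups ComplexConjugate NNReal ENNReal Pointwise InnerProductSpace InnerProduct

namespace Literature.NumberTheory.Automorphic

namespace Fuchsian

variable {Γ : Subgroup (GL (Fin 2) ℝ)} {F : Set ℍ} {h : ℕ} {𝔞 : Fin h → OnePoint ℝ} {σ : Fin h → SL(2, ℝ)}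

set_option quotPrecheck false in
/-- `L²(F)`. -/
local notation "L2F" => Lp ℂ 2 ((volume : Measure ℍ).restrict F)

/-! ## 1. The truncation projection `Λ = 1 - Σ_i V_i V_i†` -/

section Projection

variable (hΓ : Γ ≤ (Matrix.SpecialLinearGroup.toGL : SL(2, ℝ) →* GL (Fin 2) ℝ).range)
  (hneg : (-1 : GL (Fin 2) ℝ) ∈ Γ) (hd : IsDiscreteSubgroup Γ) (hF : IsHypFundamentalDomain Γ F)
  (hinfty : ∀ i, (Matrix.SpecialLinearGroup.toGL (σ i) : GL (Fin 2) ℝ) • (OnePoint.infty : OnePoint ℝ) = 𝔞 i)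
  (hper : ∀ i, (ConjAct.toConjAct (Matrix.SpecialLinearGroup.toGL (σ i) : GL (Fin 2) ℝ)⁻¹ • Γ).strictPeriods =
    AddSubgroup.zmultiples 1)
  (hineq : ∀ i j, ∀ γ ∈ Γ, γ • 𝔞 i = 𝔞 j → i = j)
  {Y : ℝ} (hY : 1 ≤ Y)

/-- The cusp isometry of the cusp `𝔞_i` as a bounded operator `L²((log Y, ∞)) → L²(F)`. [cite: Iwaniec2002, §3.2 & (6.29), PDF pp. 43, 88] -/
def cuspV (i : Fin h) : Lp ℂ 2 ((volume : Measure ℝ).restrict (Ioi (Real.log Y))) →L[ℂ] L2F :=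
  (cuspIsometry hΓ hneg hd hF (σ i) (hper i) hY).toContinuousLinearMap

/-- `V_i` is the cusp isometry. [folklore] -/
theorem cuspV_apply (i : Fin h) (f : Lp ℂ 2 ((volume : Measure ℝ).restrict (Ioi (Real.log Y)))) :
    cuspV hΓ hneg hd hF hper hY i f = cuspIsometry hΓ hneg hd hF (σ i) (hper i) hY f := rfl

/-- **The truncation data**: `Q = Σ_i V_i V_i†`, the orthogonal projection onto the functions of the
height above `Y` in the cuspidal zones. [cite: Iwaniec2002, §6.4 (6.29), PDF p. 88] -/
def cuspQ : L2F →L[ℂ] L2F := ∑ i, cuspV hΓ hneg hd hF hper hY i ∘L (cuspV hΓ hneg hd hF hper hY i)†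

/-- **The truncation operator `Λ = 1 - Q`**: subtracting from `f` its constant terms above `Y` in every
cusp ((6.29)). [cite: Iwaniec2002, §6.4 (6.29), PDF p. 88] -/
def truncOp : L2F →L[ℂ] L2F := 1 - cuspQ hΓ hneg hd hF hper hY

/-- `V_i† V_i = 1` (isometry). [folklore] -/
theorem adjoint_cuspV_comp_self (i : Fin h) :
    (cuspV hΓ hneg hd hF hper hY i)† ∘L cuspV hΓ hneg hd hF hper hY i = 1 := by
  refine ContinuousLinearMap.ext fun f => ?_
  refine ext_inner_right ℂ fun g => ?_
  rw [ContinuousLinearMap.comp_apply, ContinuousLinearMap.adjoint_inner_left, one_apply_eq_self,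
    cuspV_apply, cuspV_apply, LinearIsometry.inner_map_map]

include hinfty hineq in
/-- `V_i† V_j = 0` for `i ≠ j` (orthogonal ranges). [cite: Iwaniec2002, §2.2 (2.3)–(2.5) & §7.3, PDF pp. 30–31, 75] -/
theorem adjoint_cuspV_comp_of_ne {i j : Fin h} (hij : i ≠ j) :
    (cuspV hΓ hneg hd hF hper hY i)† ∘L cuspV hΓ hneg hd hF hper hY j = 0 := by
  refine ContinuousLinearMap.ext fun f => ?_
  refine ext_inner_left ℂ fun g => ?_
  rw [ContinuousLinearMap.comp_apply, ContinuousLinearMap.adjoint_inner_right, zero_apply,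
    inner_zero_right, cuspV_apply, cuspV_apply]
  exact inner_cuspIsometry_eq_zero_of_ne hΓ hneg hd hF hinfty hper hineq hij hY g f

include hinfty hineq in
/-- **`V_i† Λ = 0`**: the truncated function has no component of the height above `Y` in any cusp. [cite: Iwaniec2002, §6.4 (6.29), PDF p. 88] -/
theorem adjoint_cuspV_comp_truncOp (i : Fin h) :
    (cuspV hΓ hneg hd hF hper hY i)† ∘L truncOp hΓ hneg hd hF hper hY = 0 := by
  unfold truncOp cuspQ
  rw [ContinuousLinearMap.comp_sub, ContinuousLinearMap.comp_finsetSum]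
  have e : ∀ j, (cuspV hΓ hneg hd hF hper hY i)† ∘L (cuspV hΓ hneg hd hF hper hY j ∘L (cuspV hΓ hneg hd hF hper hY j)†) =
      if i = j then (cuspV hΓ hneg hd hF hper hY i)† else 0 := by
    intro j
    rw [← ContinuousLinearMap.comp_assoc]
    split_ifs with hij
    · subst hij; rw [adjoint_cuspV_comp_self, ContinuousLinearMap.one_def, ContinuousLinearMap.id_comp]
    · rw [adjoint_cuspV_comp_of_ne hΓ hneg hd hF hinfty hper hineq hY hij, ContinuousLinearMap.zero_comp]
  simp_rw [e]
  rw [Finset.sum_ite_eq, if_pos (Finset.mem_univ i), ContinuousLinearMap.one_def, ContinuousLinearMap.comp_id, sub_self]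

/-- `Q` is self-adjoint. [folklore] -/
theorem isSelfAdjoint_cuspQ : IsSelfAdjoint (cuspQ hΓ hneg hd hF hper hY) := by
  unfold cuspQ
  refine isSelfAdjoint_sum _ fun i _ => ?_
  rw [IsSelfAdjoint, ContinuousLinearMap.star_eq_adjoint, ContinuousLinearMap.adjoint_comp,
    ContinuousLinearMap.adjoint_adjoint]

include hinfty hineq in
/-- `Q² = Q`. [folklore] -/
theorem cuspQ_mul_cuspQ : cuspQ hΓ hneg hd hF hper hY * cuspQ hΓ hneg hd hF hper hY = cuspQ hΓ hneg hd hF hper hY := by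
  unfold cuspQ
  rw [Finset.sum_mul]
  refine Finset.sum_congr rfl fun i _ => ?_
  rw [Finset.mul_sum]
  have e : ∀ j, cuspV hΓ hneg hd hF hper hY i ∘L (cuspV hΓ hneg hd hF hper hY i)† *
      (cuspV hΓ hneg hd hF hper hY j ∘L (cuspV hΓ hneg hd hF hper hY j)†) =
      if i = j then cuspV hΓ hneg hd hF hper hY i ∘L (cuspV hΓ hneg hd hF hper hY i)† else 0 := by
    intro j
    rw [ContinuousLinearMap.mul_def, ContinuousLinearMap.comp_assoc, ← ContinuousLinearMap.comp_assoc _ (cuspV hΓ hneg hd hF hper hY j)]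
    split_ifs with hij
    · subst hij; rw [adjoint_cuspV_comp_self, ContinuousLinearMap.one_def, ContinuousLinearMap.id_comp]
    · rw [adjoint_cuspV_comp_of_ne hΓ hneg hd hF hinfty hper hineq hY hij, ContinuousLinearMap.zero_comp,
        ContinuousLinearMap.comp_zero]
  simp_rw [e]
  rw [Finset.sum_ite_eq, if_pos (Finset.mem_univ i)]

include hinfty hineq in
/-- `Q` is a star projection. [folklore] -/
theorem isStarProjection_cuspQ : IsStarProjection (cuspQ hΓ hneg hd hF hper hY) :=
  ⟨cuspQ_mul_cuspQ hΓ hneg hd hF hinfty hper hineq hY, isSelfAdjoint_cuspQ hΓ hneg hd hF hper hY⟩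

include hinfty hineq in
/-- `Λ` is a star projection. [folklore] -/
theorem isStarProjection_truncOp : IsStarProjection (truncOp hΓ hneg hd hF hper hY) :=
  (isStarProjection_cuspQ hΓ hneg hd hF hinfty hper hineq hY).one_sub

include hinfty hineq in
/-- `Λ` is self-adjoint. [folklore] -/
theorem isSelfAdjoint_truncOp : IsSelfAdjoint (truncOp hΓ hneg hd hF hper hY) :=
  (isStarProjection_truncOp hΓ hneg hd hF hinfty hper hineq hY).isSelfAdjoint

include hinfty hineq in
/-- `‖Λ f‖ ≤ ‖f‖`. [folklore] -/
theorem norm_truncOp_apply_le (f : L2F) : ‖truncOp hΓ hneg hd hF hper hY f‖ ≤ ‖f‖ := by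
  have h := (isStarProjection_truncOp hΓ hneg hd hF hinfty hper hineq hY)
  calc ‖truncOp hΓ hneg hd hF hper hY f‖ ≤ ‖truncOp hΓ hneg hd hF hper hY‖ * ‖f‖ := ContinuousLinearMap.le_opNorm _ _
    _ ≤ 1 * ‖f‖ := by gcongr; exact IsStarProjection.norm_le _ h
    _ = ‖f‖ := one_mul _

include hinfty hineq in
/-- `‖Q f‖ ≤ ‖f‖`. [folklore] -/
theorem norm_cuspQ_apply_le (f : L2F) : ‖cuspQ hΓ hneg hd hF hper hY f‖ ≤ ‖f‖ := by
  have h := (isStarProjection_cuspQ hΓ hneg hd hF hinfty hper hineq hY)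
  calc ‖cuspQ hΓ hneg hd hF hper hY f‖ ≤ ‖cuspQ hΓ hneg hd hF hper hY‖ * ‖f‖ := ContinuousLinearMap.le_opNorm _ _
    _ ≤ 1 * ‖f‖ := by gcongr; exact IsStarProjection.norm_le _ h
    _ = ‖f‖ := one_mul _

/-- `Q f = Σ_i V_i (V_i† f)`. [folklore] -/
theorem cuspQ_apply (f : L2F) :
    cuspQ hΓ hneg hd hF hper hY f = ∑ i, cuspV hΓ hneg hd hF hper hY i (ContinuousLinearMap.adjoint (cuspV hΓ hneg hd hF hper hY i) f) := by
  unfold cuspQ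
  rw [_root_.sum_apply]
  rfl

include hinfty hineq in
/-- `‖Q f‖² = Σ_i ‖V_i† f‖²` (orthogonality and isometry). [folklore] -/
theorem norm_sq_cuspQ_apply (f : L2F) :
    ‖cuspQ hΓ hneg hd hF hper hY f‖ ^ 2 = ∑ i, ‖ContinuousLinearMap.adjoint (cuspV hΓ hneg hd hF hper hY i) f‖ ^ 2 := by
  rw [cuspQ_apply, @norm_sq_eq_re_inner ℂ, sum_inner]
  simp_rw [inner_sum]
  rw [map_sum]
  refine Finset.sum_congr rfl fun i _ => ?_
  rw [map_sum, Finset.sum_eq_single i]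
  · rw [cuspV_apply, LinearIsometry.inner_map_map, ← @norm_sq_eq_re_inner ℂ]
  · intro j _ hji
    have h0 := congrArg (fun T : _ →L[ℂ] _ => T (ContinuousLinearMap.adjoint (cuspV hΓ hneg hd hF hper hY j) f))
      (adjoint_cuspV_comp_of_ne hΓ hneg hd hF hinfty hper hineq hY hji.symm)
    simp only [ContinuousLinearMap.comp_apply, zero_apply] at h0
    rw [← ContinuousLinearMap.adjoint_inner_right, h0, inner_zero_right, map_zero]
  · intro hi; exact absurd (Finset.mem_univ i) hi

end Projection

/-! ## 2. The constant terms of `T_k(Λ f)` vanish above `Y e^{R}` -/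

section ConstantTerms

variable (hΓ : Γ ≤ (Matrix.SpecialLinearGroup.toGL : SL(2, ℝ) →* GL (Fin 2) ℝ).range)
  (hneg : (-1 : GL (Fin 2) ℝ) ∈ Γ) (hd : IsDiscreteSubgroup Γ) (hF : IsHypFundamentalDomain Γ F)
  (hinfty : ∀ i, (Matrix.SpecialLinearGroup.toGL (σ i) : GL (Fin 2) ℝ) • (OnePoint.infty : OnePoint ℝ) = 𝔞 i)
  (hper : ∀ i, (ConjAct.toConjAct (Matrix.SpecialLinearGroup.toGL (σ i) : GL (Fin 2) ℝ)⁻¹ • Γ).strictPeriods =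
    AddSubgroup.zmultiples 1)
  (hineq : ∀ i j, ∀ γ ∈ Γ, γ • 𝔞 i = 𝔞 j → i = j)
  {Y : ℝ} (hY : 1 ≤ Y) {k : ℝ → ℝ}

/-- The log-profile of a real continuous compactly supported `φ` with support in `(Y₀, ∞)`, `Y₀ ≥ 1`,
is a nice profile at level `Y₀`. [folklore] -/
theorem isNiceProfile_logProfile_ofReal {Y₀ : ℝ} (hY₀ : 1 ≤ Y₀) {φ : ℝ → ℝ} (hφc : Continuous φ)
    (hφs : HasCompactSupport φ) (hφU : tsupport φ ⊆ Ioi Y₀) :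
    ∃ b : ℝ, IsNiceProfile Y₀ b (logProfile fun y => (φ y : ℂ)) := by
  obtain ⟨b', hb'⟩ := hφs.isCompact.isBounded.subset_closedBall 0
  obtain ⟨C, hC⟩ := hφs.exists_bound_of_continuous hφc
  have hC0 : 0 ≤ C := (norm_nonneg _).trans (hC 0)
  have hφzero : ∀ t, t ≤ Y₀ → φ t = 0 := fun t ht =>
    image_eq_zero_of_notMem_tsupport fun hmem => absurd (hφU hmem) (not_lt.mpr ht)
  have hφzero' : ∀ t, b' < t → φ t = 0 := by
    intro t ht
    refine image_eq_zero_of_notMem_tsupport fun hmem => ?_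
    have := hb' hmem
    rw [Metric.mem_closedBall, dist_zero_right, Real.norm_eq_abs] at this
    linarith [le_abs_self t]
  refine ⟨Real.log (max b' 1) + 1, ⟨continuous_logProfile (Complex.continuous_ofReal.comp hφc) |>.measurable,
    ⟨C, fun v => ?_⟩, fun v hv => ?_, fun v hv => ?_⟩⟩
  · unfold logProfile
    by_cases hv : v ≤ Real.log Y₀
    · have : φ (Real.exp v) = 0 := hφzero _ (by
        calc Real.exp v ≤ Real.exp (Real.log Y₀) := Real.exp_le_exp.mpr hv
          _ = Y₀ := Real.exp_log (by linarith))
      simp [this, hC0]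
    · have hv0 : 0 ≤ v := le_trans (Real.log_nonneg hY₀) (not_le.mp hv).le
      rw [norm_mul, Complex.norm_real, Real.norm_eq_abs, abs_of_pos (Real.exp_pos _)]
      calc Real.exp (-(v / 2)) * ‖(φ (Real.exp v) : ℂ)‖ ≤ 1 * C := by
            refine mul_le_mul ?_ (by simpa using hC (Real.exp v)) (norm_nonneg _) zero_le_one
            rw [Real.exp_le_one_iff]; linarith
        _ = C := one_mul C
  · unfold logProfile
    have : φ (Real.exp v) = 0 := hφzero _ (by
      calc Real.exp v ≤ Real.exp (Real.log Y₀) := Real.exp_le_exp.mpr hv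
        _ = Y₀ := Real.exp_log (by linarith))
    simp [this]
  · unfold logProfile
    have h1 : b' < Real.exp v := by
      calc b' ≤ max b' 1 := le_max_left _ _
        _ = Real.exp (Real.log (max b' 1)) := (Real.exp_log (lt_of_lt_of_le one_pos (le_max_right _ _))).symm
        _ < Real.exp v := Real.exp_lt_exp.mpr (by linarith)
    simp [hφzero' _ h1]

include hΓ hneg hd hF hinfty hper hineq in
/-- **The constant terms of `T_k(Λf)` vanish above `Y e^{R}`** (`R = 2 arsinh √M`, `k = 0` on
`[M, ∞)`): for `f ∈ L²(F)` and a Lipschitz test kernel `k`, the continuous automorphic function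
`T_k(Λf) = L_k((Λf)^Γ)` has `(T_k Λ f)_{𝔞_i}(v) = 0` for `Im v > Y e^{R}`. (For a real test
profile `φ` supported in `(Ye^R, ∞)`: `∫_F E_𝔞ᵢ(·|φ) T_kΛf = ⟨T_k V_i Ψ_φ, Λ f⟩ = ⟨V_i(g ⋆ Ψ_φ), Λf⟩
= ⟨g ⋆ Ψ_φ, V_i†Λ f⟩ = 0`.) This is the input "`(g^Γ)_𝔞 = 0`" of the cusp decay of Propositions
4.3–4.5, for the range of `Λ` instead of the cusp forms. [cite: Iwaniec2002, §4.2 Props. 4.3–4.5 & §6.4 (6.29), PDF pp. 49–51, 88] -/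
theorem cuspMeanAt_kernelOp_truncOp_eq_zero (hk : IsTestKernel k) {L : ℝ≥0} (hL : LipschitzWith L k)
    {M : ℝ} (hM : ∀ u, M ≤ u → k u = 0) (hM0 : 0 ≤ M) (i : Fin h) (f : L2F) {v : ℍ}
    (hv : Y * Real.exp (2 * Real.arsinh (Real.sqrt M)) < v.im) :
    cuspMeanAt (σ i) (kernelOp Γ F k (truncOp hΓ hneg hd hF hper hY f)) v = 0 := by
  set R : ℝ := 2 * Real.arsinh (Real.sqrt M) with hR
  have hR0 : 0 ≤ R := mul_nonneg zero_le_two (Real.arsinh_nonneg_iff.mpr (Real.sqrt_nonneg _))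
  set Yh : ℝ := Y * Real.exp R with hYh
  have hYh1 : 1 ≤ Yh := le_trans hY (le_mul_of_one_le_right (by linarith) (Real.one_le_exp hR0))
  have hYh0 : 0 < Yh := by linarith
  set g : L2F := truncOp hΓ hneg hd hF hper hY f with hg
  set G : ℍ → ℂ := kernelOp Γ F k g with hG
  have hGl := locallyIntegrable_autExt hΓ hneg hd hF (Lp.memLp g)
  have hGeq : G = invariantOperator k (autExt Γ F g) :=
    funext fun z => kernelOp_eq_invariantOperator hΓ hneg hd hF hk (Lp.memLp g) z
  have hGc : Continuous G := by rw [hGeq]; exact continuous_invariantOperator hk hL hM hGl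
  have hGa : IsAutomorphic Γ G := isAutomorphic_kernelOp hΓ hd hk _
  refine cuspMeanAt_eq_zero_of_orthogonal hΓ hneg hd hF (σ i) (hper i) hYh1 hGc hGa
    (fun φ hφc hφs hφU => ?_) hv
  -- the nice profile `Ψ_φ` at level `Yh`
  obtain ⟨b, hnice⟩ := isNiceProfile_logProfile_ofReal hYh1 hφc hφs hφU
  have hφzero : ∀ t ≤ Yh, ((φ t : ℂ)) = 0 := fun t ht => by
    rw [image_eq_zero_of_notMem_tsupport (f := φ) fun hmem => absurd (hφU hmem) (not_lt.mpr ht), Complex.ofReal_zero]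
  set ψ := logProfile fun y => (φ y : ℂ) with hψ
  set x : L2F := cuspIsometry hΓ hneg hd hF (σ i) (hper i) hYh1 (hnice.memLp.toLp ψ) with hx
  have hxrep : (x : ℍ → ℂ) =ᵐ[volume.restrict F] incEisCusp Γ (σ i) (fun y => (φ y : ℂ)) := by
    rw [incEisCusp_eq_cuspLift (Γ := Γ) (σ i) hYh0 hφzero]
    exact cuspIsometry_toLp_coeFn hΓ hneg hd hF (σ i) (hper i) hYh1 hnice.measurable hnice.memLp
  -- realness of `E_𝔞ᵢ(·|φ)`
  have hreal : ∀ z, conj (incEisCusp Γ (σ i) (fun y => (φ y : ℂ)) z) = incEisCusp Γ (σ i) (fun y => (φ y : ℂ)) z := by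
    intro z
    rw [conj_incEisCusp hΓ hneg hd (σ i) (hper i) hYh1 hφzero]
    simp only [Complex.conj_ofReal]
  -- the integral as an inner product
  set y : L2F := kernelCLM hΓ hneg hd hF hk hL.continuous g with hy
  have hyrep : (y : ℍ → ℂ) =ᵐ[volume.restrict F] G := kernelCLM_coeFn hΓ hneg hd hF hk hL.continuous g
  have hinner : ∫ z in F, incEisCusp Γ (σ i) (fun y => (φ y : ℂ)) z * G z = ⟪x, y⟫_ℂ := by
    rw [L2.inner_def]
    refine integral_congr_ae ?_
    filter_upwards [hxrep, hyrep] with z hz hz'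
    rw [RCLike.inner_apply, hz, hz', hreal, mul_comm]
  rw [hinner]
  -- self-adjointness and the cusp action
  have hsa := isSelfAdjoint_kernelCLM hΓ hneg hd hF hk hL.continuous
  have h1 : ⟪x, y⟫_ℂ = ⟪kernelCLM hΓ hneg hd hF hk hL.continuous x, g⟫_ℂ := by
    rw [hy, ← ContinuousLinearMap.adjoint_inner_left, hsa.adjoint_eq]
  have h2 : kernelCLM hΓ hneg hd hF hk hL.continuous x =
      cuspIsometry hΓ hneg hd hF (σ i) (hper i) hY
        ((hnice.profileConv hk hM hM0 (by linarith) le_rfl).memLp.toLp _) :=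
    kernelCLM_cuspIsometry hΓ hneg hd hF (σ i) (hper i) hk hL.continuous hM hM0 hY le_rfl hnice
  rw [h1, h2, ← cuspV_apply hΓ hneg hd hF hper hY, ← ContinuousLinearMap.adjoint_inner_right, hg,
    ← ContinuousLinearMap.comp_apply, adjoint_cuspV_comp_truncOp hΓ hneg hd hF hinfty hper hineq hY i,
    zero_apply, inner_zero_right]

end ConstantTerms

/-! ## 3. Cusp decay for functions with vanishing constant terms above a level; compactness of `T_k ∘ Λ` -/

section Compact

variable (hΓ : Γ ≤ (Matrix.SpecialLinearGroup.toGL : SL(2, ℝ) →* GL (Fin 2) ℝ).range)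
  (hneg : (-1 : GL (Fin 2) ℝ) ∈ Γ) (hd : IsDiscreteSubgroup Γ) (hF : IsHypFundamentalDomain Γ F)
  (hvol : volume F < ⊤)
  (hinfty : ∀ i, (Matrix.SpecialLinearGroup.toGL (σ i) : GL (Fin 2) ℝ) • (OnePoint.infty : OnePoint ℝ) = 𝔞 i)
  (hper : ∀ i, (ConjAct.toConjAct (Matrix.SpecialLinearGroup.toGL (σ i) : GL (Fin 2) ℝ)⁻¹ • Γ).strictPeriods =
    AddSubgroup.zmultiples 1)
  (hineq : ∀ i j, ∀ γ ∈ Γ, γ • 𝔞 i = 𝔞 j → i = j)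
  (hcomplete : ∀ c : OnePoint ℝ, IsCusp c Γ → ∃ i, ∃ γ ∈ Γ, γ • 𝔞 i = c)
  {k : ℝ → ℝ} {L : ℝ≥0} {M : ℝ}

include hΓ hneg hd hF hinfty hper hineq in
/-- **Cusp decay of `T_k g` at the cusp `𝔞_i` when the constant terms of `T_k g` vanish above `Y₀`**
(Props. 4.3–4.5, as in `Fuchsian.norm_kernelOp_frame_le_of_cuspidal` but with the vanishing of the
constant term of `T_k g` along the horocycle through `z` as the hypothesis): for a Lipschitz test
kernel `k` (vanishing on `[M, ∞)`), `g ∈ L²(F)` and `Im z > max(e^{R_M+1}, Y₀)`,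
`|T_k g(σ_i z)| ≤ C_k (Im z)^{-1/2} ‖g‖_{L²(F)}`. [cite: Iwaniec2002, Prop. 4.3, Cor. 4.4, Prop. 4.5, PDF pp. 49–51] -/
theorem norm_kernelOp_frame_le_of_cuspMean_eq_zero (hk : IsTestKernel k) (hL : LipschitzWith L k)
    (hM : ∀ u, M ≤ u → k u = 0) {g : ℍ → ℂ} (hg : MemLp g 2 (volume.restrict F)) (i : Fin h) {z : ℍ}
    (hz : Real.exp (kernelRadius M + 1) < z.im)
    (h0' : cuspMean (fun v : ℍ => kernelOp Γ F k g (σ i • v)) z = 0) :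
    ‖kernelOp Γ F k g (σ i • z)‖ ≤
      frameCuspConst L M * z.im ^ (-(1 / 2 : ℝ)) * Real.sqrt ((∫⁻ w in F, ‖g w‖ₑ ^ 2).toReal) := by
  set R := kernelRadius M with hR
  set G : ℍ → ℂ := autExt Γ F g with hGdef
  set G' : ℍ → ℂ := fun v => G (σ i • v) with hG'def
  have hGl : LocallyIntegrable G := locallyIntegrable_autExt hΓ hneg hd hF hg
  have hGm : AEStronglyMeasurable G volume := aestronglyMeasurable_autExt hΓ hneg hd hF hg.1
  have hG'l : LocallyIntegrable G' := locallyIntegrable_comp_sl_smul hGl (σ i)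
  have hG'm : AEStronglyMeasurable G' volume := aestronglyMeasurable_comp_sl_smul hGm (σ i)
  set Φ : ℍ → ℂ := invariantOperator k G' with hΦdef
  have hΦc : Continuous Φ := continuous_invariantOperator hk hL hM hG'l
  have eΦ' : ∀ v : ℍ, kernelOp Γ F k g (σ i • v) = Φ v := fun v => by
    rw [kernelOp_eq_invariantOperator hΓ hneg hd hF hk hg (σ i • v), hΦdef, hG'def,
      invariantOperator_comp_smul k G (σ i) v]
  have eΦ : kernelOp Γ F k g (σ i • z) = Φ z := eΦ' z
  have h0 : cuspMean Φ z = 0 := by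
    rw [show Φ = fun v : ℍ => kernelOp Γ F k g (σ i • v) from funext fun v => (eΦ' v).symm]
    exact h0'
  -- sizes
  have hR0 : 0 ≤ R := kernelRadius_nonneg M
  have hy1 : 1 ≤ z.im := le_trans (by have := Real.one_le_exp (by linarith : (0:ℝ) ≤ R + 1); linarith) hz.le
  have hy0 : 0 < z.im := z.im_pos
  have hzr : 1 < z.im * Real.exp (-(R + 1)) := by
    rw [Real.exp_neg, ← div_eq_mul_inv, lt_div_iff₀ (Real.exp_pos _), one_mul]
    exact hz
  set B := Metric.closedBall z (R + 1) with hB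
  set m : ℝ := (∫⁻ w in F, ‖g w‖ₑ ^ 2).toReal with hm
  have hmfin : ∫⁻ w in F, ‖g w‖ₑ ^ 2 ≠ ∞ := (lintegral_enorm_sq_lt_top hg).ne
  set V : ℝ := (volume (Metric.closedBall UpperHalfPlane.I (R + 1))).toReal with hV
  have hmass := lintegral_sq_autExt_frame_closedBall_le hΓ hneg hd hF hinfty hper hineq i (z := z) (r := R + 1)
    (by linarith) hzr hg.1
  have hBfin : ∫⁻ w in B, ‖G' w‖ₑ ^ 2 ≠ ∞ :=
    (lt_of_le_of_lt hmass (ENNReal.mul_lt_top ENNReal.ofReal_lt_top (lt_top_iff_ne_top.mpr hmfin))).ne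
  have hvolB : volume B ≠ ∞ := (volume_closedBall_lt_top z (R + 1)).ne
  have hint : ∫ w in B, ‖G' w‖ ≤ Real.sqrt V * Real.sqrt ((2 * (z.im * (Real.exp (R + 1) - 1)) + 4) * m) := by
    refine (integral_norm_le_sqrt_mul_sqrt hvolB hG'm hBfin).trans ?_
    rw [hB, volume_closedBall_eq z (R + 1), ← hV]
    gcongr
    have he : 0 ≤ Real.exp (R + 1) - 1 := by linarith [Real.one_le_exp (by linarith : (0:ℝ) ≤ R + 1)]
    have hpos : (0:ℝ) ≤ 2 * (z.im * (Real.exp (R + 1) - 1)) + 4 := by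
      have := mul_nonneg hy0.le he; linarith
    rw [hm, ← ENNReal.toReal_ofReal hpos, ← ENNReal.toReal_mul]
    exact ENNReal.toReal_mono (ENNReal.mul_ne_top ENNReal.ofReal_ne_top hmfin) hmass
  have hosc : ∀ ξ ∈ Icc (0 : ℝ) 1, ‖Φ z - Φ (ξ +ᵥ z)‖ ≤ oscConst L M * (1 / z.im) * ∫ w in B, ‖G' w‖ := by
    intro ξ hξ
    have hdist : dist z (ξ +ᵥ z) ≤ 1 / z.im := by
      rw [dist_comm]
      refine (dist_vadd_self_le ξ z).trans ?_
      rw [abs_of_nonneg hξ.1]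
      exact div_le_div_of_nonneg_right hξ.2 hy0.le
    have hdist1 : dist z (ξ +ᵥ z) ≤ 1 := hdist.trans (by rw [div_le_one hy0]; exact hy1)
    refine (norm_invariantOperator_sub_le hk hL hM hG'l hdist1).trans ?_
    have hI0 : 0 ≤ ∫ w in B, ‖G' w‖ := integral_nonneg fun w => norm_nonneg _
    gcongr
    exact oscConst_nonneg L M
  have hmain := norm_le_of_cuspMean_eq_zero hΦc h0 hosc
  rw [eΦ]
  refine hmain.trans ?_
  have hsq : Real.sqrt ((2 * (z.im * (Real.exp (R + 1) - 1)) + 4) * m) ≤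
      Real.sqrt z.im * Real.sqrt (2 * (Real.exp (R + 1) - 1) + 4) * Real.sqrt m := by
    have he : 0 ≤ Real.exp (R + 1) - 1 := by linarith [Real.one_le_exp (by linarith : (0:ℝ) ≤ R + 1)]
    have h24 : (0:ℝ) ≤ 2 * (Real.exp (R + 1) - 1) + 4 := by positivity
    rw [← Real.sqrt_mul hy0.le, ← Real.sqrt_mul (mul_nonneg hy0.le h24)]
    apply Real.sqrt_le_sqrt
    have hm0 : 0 ≤ m := ENNReal.toReal_nonneg
    nlinarith
  have hy_half : (1 / z.im) * Real.sqrt z.im = z.im ^ (-(1 / 2 : ℝ)) := by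
    rw [Real.sqrt_eq_rpow, Real.rpow_neg hy0.le, one_div, ← Real.rpow_neg_one, ← Real.rpow_add hy0]
    norm_num
    rw [Real.rpow_neg hy0.le]
  calc oscConst L M * (1 / z.im) * ∫ w in B, ‖G' w‖
      ≤ oscConst L M * (1 / z.im) * (Real.sqrt V * (Real.sqrt z.im * Real.sqrt (2 * (Real.exp (R + 1) - 1) + 4) * Real.sqrt m)) := by
        have : 0 ≤ oscConst L M * (1 / z.im) := mul_nonneg (oscConst_nonneg L M) (one_div_pos.mpr hy0).le
        exact mul_le_mul_of_nonneg_left (hint.trans (mul_le_mul_of_nonneg_left hsq (Real.sqrt_nonneg _))) this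
    _ = frameCuspConst L M * ((1 / z.im) * Real.sqrt z.im) * Real.sqrt m := by
        rw [frameCuspConst]; ring
    _ = frameCuspConst L M * z.im ^ (-(1 / 2 : ℝ)) * Real.sqrt m := by rw [hy_half]

include hΓ hneg hd hF hvol hinfty hper hineq hcomplete in
/-- **`T_k ∘ Λ` is a compact operator on `L²(F)`** for a finite volume group, a level `Y ≥ 1` and
every Lipschitz test kernel `k`: the compact part of the invariant integral operator (Prop. 4.5:
"the kernel `K̂ = K - H` is bounded on `F × F` … `L̂` is of Hilbert–Schmidt type"; here `Λ` removes
the constant terms above `Y`, and the proof is the total boundedness argument of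
`Fuchsian.isCompactOperator_kernelCLM_comp_cuspSubtype` with the vanishing of the constant terms of
`T_k Λ f` above `Y e^R` in place of cuspidality). [cite: Iwaniec2002, Prop. 4.3, Cor. 4.4, Prop. 4.5 & §6.4 (6.29), PDF pp. 49–51, 88] -/
theorem isCompactOperator_kernelCLM_comp_truncOp {Y : ℝ} (hY : 1 ≤ Y) (hk : IsTestKernel k)
    (hL : LipschitzWith L k) (hM : ∀ u, M ≤ u → k u = 0) (hM0 : 0 ≤ M) :
    IsCompactOperator ((kernelCLM hΓ hneg hd hF hk hL.continuous).comp (truncOp hΓ hneg hd hF hper hY)) := by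
  haveI : IsFiniteMeasure ((volume : Measure ℍ).restrict F) :=
    ⟨by rw [Measure.restrict_apply_univ]; exact hvol⟩
  have hkc : Continuous k := hL.continuous
  obtain ⟨Bk, hBk⟩ := hk.bounded
  have hBk0 : 0 ≤ Bk := (abs_nonneg _).trans (hBk 0)
  set μF := (volume : Measure ℍ).restrict F with hμF
  set T := kernelCLM hΓ hneg hd hF hk hkc with hT
  set Λop := truncOp hΓ hneg hd hF hper hY with hΛ
  set R := kernelRadius M with hR
  -- the level above which the constant terms of `T_k Λ f` vanish
  set Rk : ℝ := 2 * Real.arsinh (Real.sqrt M) with hRk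
  have hRk : Rk = R := rfl
  set Y₀ : ℝ := Y * Real.exp Rk with hY₀
  -- reduce to total boundedness of the image of the closed unit ball
  refine (isCompactOperator_iff_isCompact_closure_image_closedBall
    ((T.comp Λop : L2F →L[ℂ] L2F) : L2F →ₗ[ℂ] L2F) one_pos).mpr ?_
  rw [isCompact_iff_totallyBounded_isComplete]
  refine ⟨TotallyBounded.closure ?_, isClosed_closure.isComplete⟩
  rw [Metric.totallyBounded_iff]
  intro ε hε
  -- constants
  set Λc : ℝ := (measureUnivNNReal μF : ℝ) ^ (2 : ℝ≥0∞).toReal⁻¹ with hΛc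
  have hΛ0 : 0 ≤ Λc := by rw [hΛc]; positivity
  set β : ℝ := ε / (2 * (Λc + 1)) with hβ
  have hβ0 : 0 < β := by rw [hβ]; positivity
  set Ck := frameCuspConst L M with hCk
  have hCk0 : 0 ≤ Ck := frameCuspConst_nonneg L M
  -- the height of truncation
  set Yc : ℝ := max (max (Real.exp (R + 1)) (((2 * Ck + 1) / β) ^ 2)) Y₀ with hYc
  have hYexp : Real.exp (R + 1) ≤ Yc := (le_max_left _ _).trans (le_max_left _ _)
  have hYc0 : 0 < Yc := lt_of_lt_of_le (Real.exp_pos _) hYexp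
  have hYcY₀ : Y₀ ≤ Yc := le_max_right _ _
  have hYβ : 1 / Real.sqrt Yc ≤ β / (2 * Ck + 1) := by
    have h1 : (2 * Ck + 1) / β ≤ Real.sqrt Yc := by
      rw [Real.le_sqrt (by positivity) hYc0.le]
      exact (le_max_right _ _).trans (le_max_left _ _)
    rw [div_le_div_iff₀ (Real.sqrt_pos.mpr hYc0) (by positivity), one_mul]
    rw [div_le_iff₀ hβ0] at h1
    linarith
  -- the compact part `K_Y`, inside a ball `B(i, D₀)`
  obtain ⟨K, hK, hKcover⟩ := exists_compact_of_invHeight_le (σ := σ) hΓ hneg hd hF hvol hinfty hper hcomplete Yc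
  obtain ⟨D₀, hD₀⟩ := hK.isBounded.subset_closedBall UpperHalfPlane.I
  -- the local constant on `K_Y` and the scale `δ`
  set A : ℝ := Real.sqrt ((volume (Metric.closedBall UpperHalfPlane.I (R + 1))).toReal) *
    Real.sqrt (orbitBoundAt Γ (D₀ + (R + 1)) / 2) with hA
  have hA0 : 0 ≤ A := by rw [hA]; unfold orbitBoundAt; positivity
  set δ : ℝ := min 1 (β / (4 * (oscConst L M * A) + 1)) with hδ
  have hδ0 : 0 < δ := lt_min one_pos (div_pos hβ0 (by linarith [mul_nonneg (oscConst_nonneg L M) hA0]))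
  have hδ1 : δ ≤ 1 := min_le_left _ _
  have hδβ : 2 * (oscConst L M * A) * δ ≤ β / 2 := by
    have h1 : δ ≤ β / (4 * (oscConst L M * A) + 1) := min_le_right _ _
    have h2 : 0 ≤ oscConst L M * A := mul_nonneg (oscConst_nonneg L M) hA0
    rw [le_div_iff₀ (by linarith)] at h1
    nlinarith
  -- finite `δ`-cover of the compact `K_Y`
  obtain ⟨t, hts, htf, hcov⟩ := finite_cover_balls_of_compact hK hδ0
  haveI : Fintype t := htf.fintype
  -- point evaluations at the finitely many centres
  set Ψ : L2F → (t → ℂ) := fun g i => kernelOp Γ F k (Λop g) (i : ℍ) with hΨ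
  set ballF : Set L2F := Metric.closedBall 0 1 with hball
  -- uniform bound `|T_k (Λ g)(z)| ≤ Bk A ‖g‖` for `z ∈ K_Y`
  have hptbound : ∀ (g : L2F) (z : ℍ), z ∈ K → ‖kernelOp Γ F k g z‖ ≤ Bk * A * ‖g‖ := by
    intro g z hz
    rw [kernelOp_eq_invariantOperator hΓ hneg hd hF hk (Lp.memLp g) z]
    have hGl := locallyIntegrable_autExt hΓ hneg hd hF (Lp.memLp g)
    refine (norm_invariantOperator_le' hBk hM hGl z).trans ?_
    have hmono : ∫ w in Metric.closedBall z R, ‖autExt Γ F g w‖ ≤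
        ∫ w in Metric.closedBall z (R + 1), ‖autExt Γ F g w‖ :=
      setIntegral_mono_set ((hGl.integrableOn_isCompact (isCompact_closedBall _ _)).norm)
        (Eventually.of_forall fun w => norm_nonneg _)
        (Eventually.of_forall (Metric.closedBall_subset_closedBall (by linarith)))
    have hloc := integral_norm_autExt_closedBall_le' hΓ hneg hd hF M (Lp.memLp g) (hD₀ hz)
    rw [← norm_eq_sqrt_lintegral' g, ← hR, ← hA] at hloc
    rw [mul_assoc]
    exact mul_le_mul_of_nonneg_left (hmono.trans hloc) hBk0
  have hΛnorm : ∀ g : L2F, ‖Λop g‖ ≤ ‖g‖ := fun g => norm_truncOp_apply_le hΓ hneg hd hF hinfty hper hineq hY g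
  -- the image of the unit ball under `Ψ` is bounded, hence totally bounded
  have hΨbdd : Ψ '' ballF ⊆ Metric.closedBall 0 (Bk * A) := by
    rintro _ ⟨g, hg, rfl⟩
    rw [Metric.mem_closedBall, dist_zero_right, pi_norm_le_iff_of_nonneg (by positivity)]
    intro i
    have hg1 : ‖g‖ ≤ 1 := by
      rw [hball, Metric.mem_closedBall, dist_zero_right] at hg
      exact hg
    calc ‖Ψ g i‖ ≤ Bk * A * ‖Λop g‖ := hptbound (Λop g) i (hts i.2)
      _ ≤ Bk * A * 1 := by gcongr; exact (hΛnorm g).trans hg1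
      _ = Bk * A := mul_one _
  have hΨtb : TotallyBounded (Ψ '' ballF) :=
    (isCompact_closedBall _ _).totallyBounded.subset hΨbdd
  -- a finite `β/2`-net of evaluation vectors inside the image
  obtain ⟨u, hu_sub, huf, hucov⟩ := hΨtb.exists_subset (Metric.dist_mem_uniformity (half_pos hβ0))
  have hpre : ∀ y ∈ u, ∃ g ∈ ballF, Ψ g = y := fun y hy => hu_sub hy
  choose! gsel hgsel_mem hgsel_eq using hpre
  refine ⟨(fun y => (T.comp Λop) (gsel y)) '' u, huf.image _, ?_⟩
  -- covering
  rintro _ ⟨g, hg, rfl⟩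
  obtain ⟨y, hyu, hy⟩ : ∃ y ∈ u, dist (Ψ g) y < β / 2 := by
    have := hucov ⟨g, hg, rfl⟩
    simpa only [mem_iUnion, mem_setOf_eq, exists_prop] using this
  rw [mem_iUnion₂]
  refine ⟨(T.comp Λop) (gsel y), mem_image_of_mem _ hyu, ?_⟩
  rw [Metric.mem_ball, dist_eq_norm]
  change ‖(T.comp Λop) g - (T.comp Λop) (gsel y)‖ < ε
  rw [← map_sub]
  -- the difference `hh = Λ (g - gsel y)`, `‖hh‖ ≤ 2`, with small evaluations at the centres
  set hh : L2F := Λop (g - gsel y) with hhh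
  have hg1 : ‖g‖ ≤ 1 := by
    rw [hball, Metric.mem_closedBall, dist_zero_right] at hg; exact hg
  have hgy1 : ‖gsel y‖ ≤ 1 := by
    have := hgsel_mem y hyu
    rw [hball, Metric.mem_closedBall, dist_zero_right] at this; exact this
  have hh2 : ‖hh‖ ≤ 2 := by
    rw [hhh]
    exact (hΛnorm _).trans ((norm_sub_le _ _).trans (by linarith))
  have hhsub : hh = Λop g - Λop (gsel y) := by rw [hhh, map_sub]
  have heval : ∀ i : t, ‖kernelOp Γ F k hh (i : ℍ)‖ < β / 2 := by
    intro i
    rw [hhsub, kernelOp_coe_sub' hΓ hneg hd hF hk hkc]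
    have h1 : dist (Ψ g) (Ψ (gsel y)) < β / 2 := by rw [hgsel_eq y hyu]; exact hy
    have h2 := (dist_le_pi_dist (Ψ g) (Ψ (gsel y)) i).trans_lt h1
    rwa [dist_eq_norm] at h2
  -- vanishing of the constant terms of `T_k hh` above `Y₀` and the automorphic extension of `hh`
  have hhcusp : ∀ i (v : ℍ), Y₀ < v.im → cuspMean (fun w : ℍ => kernelOp Γ F k hh (σ i • w)) v = 0 := by
    intro i v hv
    have h := cuspMeanAt_kernelOp_truncOp_eq_zero hΓ hneg hd hF hinfty hper hineq hY hk hL hM hM0 i (g - gsel y) hv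
    rw [← hhh] at h
    exact h
  have hhmem : MemLp (hh : ℍ → ℂ) 2 μF := Lp.memLp _
  have hHl := locallyIntegrable_autExt hΓ hneg hd hF hhmem
  have hauto : IsAutomorphic Γ (kernelOp Γ F k (hh : ℍ → ℂ)) := isAutomorphic_kernelOp hΓ hd hk _
  -- the pointwise bound `‖T_k hh(z)‖ ≤ β` on the compact part
  have hcpt : ∀ z ∈ K, ‖kernelOp Γ F k hh z‖ ≤ β := by
    intro z hzK
    obtain ⟨i, hit, hzi⟩ : ∃ i ∈ t, z ∈ Metric.ball i δ := by
      have := hcov hzK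
      simpa only [mem_iUnion, exists_prop] using this
    have hdist : dist z i ≤ 1 := (le_of_lt (Metric.mem_ball.mp hzi)).trans hδ1
    have hosc := norm_invariantOperator_sub_le hk hL hM hHl hdist
    have hloc := integral_norm_autExt_closedBall_le' hΓ hneg hd hF M hhmem (hD₀ hzK)
    rw [← norm_eq_sqrt_lintegral', ← hR, ← hA] at hloc
    have e1 := kernelOp_eq_invariantOperator hΓ hneg hd hF hk hhmem z
    have e2 := kernelOp_eq_invariantOperator hΓ hneg hd hF hk hhmem (i : ℍ)
    have hev := heval ⟨i, hit⟩
    calc ‖kernelOp Γ F k hh z‖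
        ≤ ‖kernelOp Γ F k hh z - kernelOp Γ F k hh i‖ + ‖kernelOp Γ F k hh i‖ := norm_le_norm_sub_add _ _
      _ ≤ oscConst L M * dist z i * (A * ‖hh‖) + β / 2 := by
          refine add_le_add ?_ hev.le
          rw [e1, e2]
          refine hosc.trans ?_
          exact mul_le_mul_of_nonneg_left hloc (mul_nonneg (oscConst_nonneg L M) dist_nonneg)
      _ ≤ oscConst L M * δ * (A * 2) + β / 2 := by
          have hzi' : dist z i ≤ δ := le_of_lt (Metric.mem_ball.mp hzi)
          exact add_le_add (mul_le_mul (mul_le_mul_of_nonneg_left hzi' (oscConst_nonneg L M))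
            (mul_le_mul_of_nonneg_left hh2 hA0) (mul_nonneg hA0 (norm_nonneg _))
            (mul_nonneg (oscConst_nonneg L M) hδ0.le)) le_rfl
      _ = 2 * (oscConst L M * A) * δ + β / 2 := by ring
      _ ≤ β / 2 + β / 2 := by linarith
      _ = β := by ring
  -- the pointwise bound everywhere, by the height partition and automorphy
  have hpw : ∀ w : ℍ, ‖kernelOp Γ F k hh w‖ ≤ β := by
    intro w
    by_cases hwY : invHeight Γ σ w ≤ Yc
    · obtain ⟨γ, hγ, hγw⟩ := hKcover w hwY
      rw [← hauto γ hγ w]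
      exact hcpt _ hγw
    · -- high in a cusp
      push Not at hwY
      obtain ⟨γ, hγ, i, v, hv, e⟩ := exists_smul_mem_cuspStrip_of_lt hper hYc0.le hwY
      have hvY : Yc < v.im := hv.2.2
      rw [← hauto γ hγ w, ← e]
      have hvexp : Real.exp (R + 1) < v.im := lt_of_le_of_lt hYexp hvY
      have hc := norm_kernelOp_frame_le_of_cuspMean_eq_zero hΓ hneg hd hF hinfty hper hineq hk hL hM hhmem i hvexp
        (hhcusp i v (lt_of_le_of_lt hYcY₀ hvY))
      rw [← norm_eq_sqrt_lintegral', ← hCk, rpow_neg_one_half_eq_one_div_sqrt v.im_pos] at hc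
      refine le_trans (le_of_eq ?_) (hc.trans ?_)
      · rfl
      have h1 : 1 / Real.sqrt v.im ≤ 1 / Real.sqrt Yc :=
        one_div_le_one_div_of_le (Real.sqrt_pos.mpr hYc0) (Real.sqrt_le_sqrt hvY.le)
      calc Ck * (1 / Real.sqrt v.im) * ‖(hh : L2F)‖ ≤ Ck * (β / (2 * Ck + 1)) * 2 :=
            mul_le_mul (mul_le_mul_of_nonneg_left (h1.trans hYβ) hCk0) hh2 (norm_nonneg _)
              (mul_nonneg hCk0 (by positivity))
        _ ≤ β := by
            rw [mul_div_assoc', div_mul_eq_mul_div, div_le_iff₀ (by linarith)]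
            nlinarith
  -- integrate the pointwise bound
  have hae : ∀ᵐ w ∂μF, ‖(T hh) w‖ ≤ β := by
    have h1 := kernelCLM_coeFn hΓ hneg hd hF hk hkc hh
    filter_upwards [h1] with w hw1
    rw [hT, hw1]
    exact hpw w
  have hnorm := Lp.norm_le_of_ae_bound hβ0.le hae
  rw [← hΛc] at hnorm
  have e : (T.comp Λop) (g - gsel y) = T hh := rfl
  rw [e]
  calc ‖T hh‖ ≤ Λc * β := hnorm
    _ ≤ (Λc + 1) * β := by gcongr; linarith
    _ = ε / 2 := by rw [hβ]; field_simp
    _ < ε := half_lt_self hε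

end Compact

end Fuchsian

end Literature.NumberTheory.Automorphic

end
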